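import Literature.NumberTheory.GaloisRepresentations.HerbrandQuotientFormula
import Mathlib.Algebra.TrivSqZeroExt.Basic
import Mathlib.Data.ZMod.Defs
import HarnessLib

/-!
# Serre's index formula `IndexFormula` (Ch. IV §1, Prop. 3): discharge and scope

`HerbrandTheorem.lean` introduces Serre's Proposition IV.3 (*Local Fields*, Ch. IV §1, p. 63,
"proof after J. Tate") as the **hypothesis** `IndexFormula 𝔓 𝔮 π : Prop` on abstract data — a group
`G` acting on `(S, 𝔓)`, a group `Q` acting on `(S', 𝔮)`, a homomorphism `π : G →* Q` — namely
`#H_0 · i_Q(π s) = Σ_{t ∈ H} i_G(s t)` for `s ∈ G_0 ∖ H`, `H = ker π` (Serre: `i_{G/H}(σ) =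
(1/e') Σ_{s → σ} i_G(s)`, `e' = e_{L/K'} = #H_0`), and derives Herbrand's theorem from it.  Although
written `def IndexFormula : Prop := …`, the declaration takes the section variables `𝔓 𝔮 π` as
arguments: it is a *predicate* on the data, not a closed named fact, and it is **not** valid for
arbitrary data (`not_forall_indexFormula` below: `π = id`, `𝔮 = ⊤` on the dual numbers `𝔽₃[ε]`).
What Serre proves — and what the tree proves, completion-free, in
`HerbrandQuotientFormula.lean` (`indexFormula_of_galoisQuotientData`, Galois quotient data over
Dedekind domains) — is the formula for the data coming from a Galois tower.  This file records:

* `IndexFormula_holds R E 𝔓` — **the discharge of the hypothesis in Serre's setting** (globalised as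
  in Ch. IV §1 Remark 2, p. 64): `R` Dedekind with fraction field `K`, `L/K` finite Galois, `E/K` a
  normal subextension, `𝔓` a maximal ideal of `S_L = integralClosure R L` whose residue extension
  over `𝔓 ∩ R` is separable; then `IndexFormula 𝔓 (𝔓 ∩ S_E) (Gal(L/K) → Gal(E/K))`.  These are
  exactly the hypotheses of the named fact `herbrand_quotient R E` (`RamificationFiltration.lean`),
  whose discharge `herbrand_quotient_holds` (`ArtinConductorHerbrandProofs.lean`) establishes the
  same instance internally; here it is exported as a theorem, from
  `indexFormula_of_galoisQuotientData` with `R₀ = R` and `e(𝔓 | 𝔓 ∩ E) = #H_0`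
  (`emultiplicity_map_under_eq_card_inertia_of_isSeparable`).
* `IndexFormulaGalois R E` / `IndexFormulaGalois_holds` — the same statement as a *closed* named
  fact in the format of `herbrand_quotient R E` (all hypotheses bound inside the `Prop`), i.e. the
  corrected, dischargeable form of "`IndexFormula` holds", and its proof.
* `not_forall_indexFormula` — the abstract predicate fails for some data: on `S = 𝔽₃[ε]`
  (`TrivSqZeroExt (ZMod 3) (ZMod 3)`) with `G = Q = Aut(S)`, `π = id`, `𝔓 = (ε)`, `𝔮 = ⊤` and
  `s : ε ↦ -ε` one has `s ∈ G_0 ∖ G_1` for `𝔓` (so the right-hand side is `i_G(s) = 1`) while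
  `i_Q(s) = ∞` for `𝔮 = ⊤`.  Hence no theorem `∀ 𝔓 𝔮 π, IndexFormula 𝔓 𝔮 π` exists; the
  dischargeable statement is the tower form `IndexFormula_holds` / `IndexFormulaGalois_holds`.

## References

* J.-P. Serre, *Local Fields*, GTM 67, Springer 1979: Ch. IV §1, Prop. 3 (pp. 62–63, proof after
  Tate) and Remark 2 (p. 64, globalisation to Dedekind domains with separable residue extension);
  Ch. I §7, Cor. to Prop. 22 (`#T = e`). [SerreLocalFields1979]
* J. Neukirch, *Algebraic Number Theory*, Springer 1999, Ch. II §10. [NeukirchANT1999]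
-/

noncomputable section

open scoped Pointwise

namespace Literature.NumberTheory.GaloisRepresentations

/-! ### The index formula for `Gal(L/K) → Gal(E/K)` on integral closures -/

section GaloisTower

variable (R : Type*) {K L : Type*} [CommRing R] [Field K] [Field L] [Algebra R K] [Algebra R L]
  [Algebra K L] [IsScalarTower R K L] (E : IntermediateField K L)

set_option synthInstance.maxHeartbeats 400000 in
set_option maxHeartbeats 1600000 in
/-- **Serre's index formula (Prop. IV.3) holds for a Galois tower `L/E/K` over a Dedekind domain.**
Let `R` be a Dedekind domain with fraction field `K`, `L/K` finite Galois with group `G`, `E/K` a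
normal subextension with `H = Gal(L/E) = ker (G → Gal(E/K))`, `S_L = integralClosure R L`,
`S_E = integralClosure R E`, and `𝔓` a maximal ideal of `S_L` whose residue extension over `𝔓 ∩ R`
is separable.  Then for every `s ∈ G_0(𝔓)` with `s ∉ H`,
`#H_0(𝔓) · i_{Gal(E/K)}(s|_E) = Σ_{t ∈ H} i_G(s t)` (indices of `Gal(E/K)` taken at `𝔓 ∩ S_E`),
i.e. the tree's hypothesis `IndexFormula 𝔓 (𝔓 ∩ S_E) (Gal(L/K) → Gal(E/K))` of
`HerbrandTheorem.lean` holds.  This is Serre's `i_{G/H}(σ) = (1/e') Σ_{s → σ} i_G(s)`,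
`e' = e_{L/K'}`, in the global form of Ch. IV §1 Remark 2, with `e' = #H_0` (Ch. I §7, Cor. to
Prop. 22, separable residue extension).  Proof: the data
`(S_L, S_E, Gal(L/K), Gal(E/K), restriction, inclusion)` are Galois quotient data — `Gal(L/K)` acts
faithfully on `S_L` (`K = Frac R`), the inclusion is injective and equivariant, and
`S_L^{Gal(L/E)} = S_E` by the Galois correspondence — so `indexFormula_of_galoisQuotientData`
(`HerbrandQuotientFormula.lean`, Serre's proof after Tate made completion-free) applies with base
`R₀ = R`, the residue extension of `𝔓` over `𝔓 ∩ S_E` being separable (tower over `𝔓 ∩ R`) so that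
`e(𝔓 | 𝔓 ∩ S_E) = #H_0` (`emultiplicity_map_under_eq_card_inertia_of_isSeparable`).
Ref: Serre, *Local Fields*, Ch. IV §1, Prop. 3 (p. 63) and Remark 2 (p. 64).
[cite: SerreLocalFields1979, Ch. IV §1 Prop. 3 (p. 63) and Remark 2 (p. 64)] -/
theorem IndexFormula_holds [IsDedekindDomain R] [IsFractionRing R K] [FiniteDimensional K L]
    [IsGalois K L] [Normal K E] (𝔓 : Ideal (integralClosure R L)) [𝔓.IsMaximal]
    [Algebra.IsSeparable (R ⧸ 𝔓.under R) (integralClosure R L ⧸ 𝔓)] :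
    IndexFormula 𝔓 (𝔓.comap (E.integralClosureInclusion R))
      (AlgEquiv.restrictNormalHom E : (L ≃ₐ[K] L) →* (E ≃ₐ[K] E)) := by
  classical
  -- the data
  haveI : Algebra.IsSeparable K L := IsGalois.to_isSeparable
  haveI : IsGalois K E := ⟨⟩
  haveI : IsDedekindDomain (integralClosure R L) := integralClosure.isDedekindDomain R K L
  haveI : IsDedekindDomain (integralClosure R E) := integralClosure.isDedekindDomain R K E
  haveI : IsFractionRing (integralClosure R L) L :=
    integralClosure.isFractionRing_of_finite_extension K L
  haveI : IsFractionRing (integralClosure R E) E :=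
    integralClosure.isFractionRing_of_finite_extension K E
  haveI : FaithfulSMul (L ≃ₐ[K] L) (integralClosure R L) :=
    (IsGaloisGroup.of_isFractionRing (L ≃ₐ[K] L) R (integralClosure R L) K L).faithful
  haveI : FaithfulSMul (E ≃ₐ[K] E) (integralClosure R E) :=
    (IsGaloisGroup.of_isFractionRing (E ≃ₐ[K] E) R (integralClosure R E) K E).faithful
  haveI : Module.Finite R (integralClosure R L) :=
    IsIntegralClosure.finite R K L (integralClosure R L)
  let π : (L ≃ₐ[K] L) →* (E ≃ₐ[K] E) := AlgEquiv.restrictNormalHom E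
  let ι : integralClosure R E →+* integralClosure R L := (E.integralClosureInclusion R).toRingHom
  have hι : Function.Injective ι := E.integralClosureInclusion_injective R
  have hequiv : ∀ (g : L ≃ₐ[K] L) (t : integralClosure R E), ι (π g • t) = g • ι t :=
    fun g t => E.integralClosureInclusion_restrictNormalHom_smul R g t
  have hker : π.ker = E.fixingSubgroup := IntermediateField.restrictNormalHom_ker E
  have hfix : ∀ a : integralClosure R L, (∀ h : π.ker, (h : L ≃ₐ[K] L) • a = a) →
      a ∈ Set.range ι := by
    intro a ha
    have haE : (a : L) ∈ E := by
      rw [← IsGalois.fixedField_fixingSubgroup E, IntermediateField.mem_fixedField_iff]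
      intro σ hσ
      have := congrArg (fun z : integralClosure R L => (z : L)) (ha ⟨σ, hker ▸ hσ⟩)
      simpa [integralClosure.coe_smul] using this
    have hint : IsIntegral R (⟨a, haE⟩ : E) :=
      (isIntegral_algHom_iff ((E.val).restrictScalars R) (fun x y h => Subtype.ext h)).mp a.2
    exact ⟨⟨⟨a, haE⟩, hint⟩, Subtype.ext rfl⟩
  -- the hypotheses of the core form of Prop. IV.3, with `R₀ = R`
  have hsep : 𝔓 ≠ ⊥ → Algebra.IsSeparable (R ⧸ 𝔓.under R) (integralClosure R L ⧸ 𝔓) :=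
    fun _ => inferInstance
  have hcard : 𝔓 ≠ ⊥ → emultiplicity 𝔓 ((𝔓.comap ι).map ι) = Nat.card (𝔓.inertia π.ker) := by
    intro h𝔓
    letI algTS : Algebra (integralClosure R E) (integralClosure R L) := ι.toAlgebra
    have halg : algebraMap (integralClosure R E) (integralClosure R L) = ι := rfl
    have hHfix : ∀ (h : π.ker) (a : integralClosure R E), (h : L ≃ₐ[K] L) • ι a = ι a :=
      fun h a => by rw [← hequiv, h.2, one_smul]
    haveI : IsGaloisGroup π.ker (integralClosure R E) (integralClosure R L) :=
      { faithful := inferInstance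
        commutes := ⟨fun h a b => by
          change (h : L ≃ₐ[K] L) • (a • b) = a • (h : L ≃ₐ[K] L) • b
          rw [Algebra.smul_def, Algebra.smul_def, smul_mul', halg, hHfix]⟩
        isInvariant := ⟨fun b hb => by
          obtain ⟨a, ha⟩ := hfix b fun h => hb h
          exact ⟨a, ha⟩⟩ }
    haveI hRTS : IsScalarTower R (integralClosure R E) (integralClosure R L) :=
      IsScalarTower.of_algebraMap_eq fun r => ((E.integralClosureInclusion R).commutes r).symm
    haveI : Module.Finite (integralClosure R E) (integralClosure R L) :=
      Module.Finite.of_restrictScalars_finite R _ _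
    haveI : FaithfulSMul (integralClosure R E) (integralClosure R L) :=
      (faithfulSMul_iff_algebraMap_injective _ _).mpr hι
    haveI : Algebra.IsIntegral (integralClosure R E) (integralClosure R L) :=
      Algebra.IsInvariant.isIntegral _ _ π.ker
    haveI h𝔮max : (𝔓.under (integralClosure R E)).IsMaximal := Ideal.IsMaximal.under _ 𝔓
    haveI h𝔭max : (𝔓.under R).IsMaximal := Ideal.IsMaximal.under R 𝔓
    -- the residue extension of `𝔓` over `𝔓 ∩ E` is separable (tower over `𝔓 ∩ R`)
    haveI hover₁ : 𝔓.LiesOver (𝔓.under (integralClosure R E)) := ⟨rfl⟩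
    haveI hover₂ : (𝔓.under (integralClosure R E)).LiesOver (𝔓.under R) :=
      ⟨(Ideal.under_under 𝔓).symm⟩
    letI : Field (integralClosure R E ⧸ 𝔓.under (integralClosure R E)) := Ideal.Quotient.field _
    letI algq : Algebra (integralClosure R E ⧸ 𝔓.under (integralClosure R E))
        (integralClosure R L ⧸ 𝔓) := Ideal.Quotient.algebraOfLiesOver _ _
    haveI : IsScalarTower (R ⧸ 𝔓.under R)
        (integralClosure R E ⧸ 𝔓.under (integralClosure R E)) (integralClosure R L ⧸ 𝔓) :=
      IsScalarTower.of_algebraMap_eq fun r => by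
        obtain ⟨r, rfl⟩ := Ideal.Quotient.mk_surjective (I := 𝔓.under R) r
        rw [Ideal.Quotient.algebraMap_mk_of_liesOver, Ideal.Quotient.algebraMap_mk_of_liesOver,
          Ideal.Quotient.algebraMap_mk_of_liesOver, IsScalarTower.algebraMap_apply R
            (integralClosure R E) (integralClosure R L)]
    haveI : Algebra.IsSeparable (integralClosure R E ⧸ 𝔓.under (integralClosure R E))
        (integralClosure R L ⧸ 𝔓) :=
      Algebra.isSeparable_tower_top_of_isSeparable (R ⧸ 𝔓.under R)
        (integralClosure R E ⧸ 𝔓.under (integralClosure R E)) (integralClosure R L ⧸ 𝔓)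
    exact emultiplicity_map_under_eq_card_inertia_of_isSeparable π.ker 𝔓 h𝔓
  -- Prop. IV.3 for these data
  exact indexFormula_of_galoisQuotientData 𝔓 π ι hι hequiv hfix R hsep hcard

/-- **Serre's Prop. IV.3 as a closed named fact** (the dischargeable form of "`IndexFormula`
holds").  `IndexFormula 𝔓 𝔮 π` (`HerbrandTheorem.lean`) is a predicate on abstract data
`(𝔓, 𝔮, π)` and is false for some data (`not_forall_indexFormula`), so it admits no proof
`∀ 𝔓 𝔮 π, IndexFormula 𝔓 𝔮 π`; the statement Serre proves (Ch. IV §1 Prop. 3, for complete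
discretely valued `K` with separable residue extension, globalised to Dedekind domains in Remark 2)
is the formula for the data of a Galois tower.  In the format of `herbrand_quotient R E`: for `R`
Dedekind with fraction field `K`, `L/K` finite Galois, `E/K` a normal subextension and every
maximal ideal `𝔓` of `integralClosure R L` with separable residue extension over `𝔓 ∩ R`,
`IndexFormula 𝔓 (𝔓 ∩ E) (Gal(L/K) → Gal(E/K))`, i.e.
`#H_0 · i_{Gal(E/K)}(s|_E) = Σ_{t ∈ H} i_{Gal(L/K)}(s t)` for `s ∈ G_0 ∖ H`, `H = Gal(L/E)`.
Proved: `IndexFormulaGalois_holds`.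
Ref: Serre, *Local Fields*, Ch. IV §1, Prop. 3 (p. 63) and Remark 2 (p. 64).
[cite: SerreLocalFields1979, Ch. IV §1 Prop. 3 (p. 63) and Remark 2 (p. 64)] -/
def IndexFormulaGalois : Prop :=
  ∀ [IsDedekindDomain R] [IsFractionRing R K] [FiniteDimensional K L] [IsGalois K L] [Normal K E]
    (𝔓 : Ideal (integralClosure R L)) [𝔓.IsMaximal]
    [Algebra.IsSeparable (R ⧸ 𝔓.under R) (integralClosure R L ⧸ 𝔓)],
    IndexFormula 𝔓 (𝔓.comap (E.integralClosureInclusion R))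
      (AlgEquiv.restrictNormalHom E : (L ≃ₐ[K] L) →* (E ≃ₐ[K] E))

/-- **Discharge of `IndexFormulaGalois`** (Serre's Prop. IV.3 for a Galois tower over a Dedekind
domain), by `IndexFormula_holds`.
Ref: Serre, *Local Fields*, Ch. IV §1, Prop. 3 (p. 63) and Remark 2 (p. 64).
[cite: SerreLocalFields1979, Ch. IV §1 Prop. 3 (p. 63) and Remark 2 (p. 64)] -/
theorem IndexFormulaGalois_holds : IndexFormulaGalois R E := by
  intro _ _ _ _ _ 𝔓 _ _
  exact IndexFormula_holds R E 𝔓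

end GaloisTower

/-! ### The abstract predicate is not valid for arbitrary data -/

section Counterexample

/-- **`IndexFormula` is a genuine hypothesis on the data `(𝔓, 𝔮, π)`.**  It fails for
`S = S' = 𝔽₃[ε]` (the trivial square-zero extension `TrivSqZeroExt (ZMod 3) (ZMod 3)`), `G = Q` the
group of `𝔽₃`-algebra automorphisms of `S` acting tautologically, `π = id` (so `H = 1`, `#H_0 = 1`
and the sum has the single term `i_G(s)`), `𝔓 = (ε)`, `𝔮 = ⊤`, and `s : ε ↦ -ε`: `s x - x ∈ (ε)`
for all `x` and `s ε - ε = -2ε ∉ (ε)² = 0`, so `s ∈ G_0 ∖ G_1` and `i_G(s) = 1` at `𝔓`, whereas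
every `G_i` of the unit ideal is all of `G`, so `i_Q(π s) = ∞` at `𝔮 = ⊤`; the formula would read
`1 · ∞ = 1`.  (Serre's Prop. IV.3 concerns the two filtrations of *one* Galois tower at *one*
prime; cf. `IndexFormula_holds`.) [folklore] -/
theorem not_forall_indexFormula :
    ¬ ∀ (S : Type) [CommRing S] (𝔓 : Ideal S) (G : Type) [Group G] [MulSemiringAction G S]
        (S' : Type) [CommRing S'] (𝔮 : Ideal S') (Q : Type) [Group Q] [MulSemiringAction Q S']
        (π : G →* Q), IndexFormula 𝔓 𝔮 π := by
  intro h
  -- the involution `ε ↦ -ε` of `𝔽₃[ε] = TrivSqZeroExt (ZMod 3) (ZMod 3)`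
  obtain ⟨σ, hσ⟩ : ∃ σ : TrivSqZeroExt (ZMod 3) (ZMod 3) →ₐ[ZMod 3] TrivSqZeroExt (ZMod 3) (ZMod 3),
      σ = TrivSqZeroExt.map (-LinearMap.id) := ⟨_, rfl⟩
  have hσσ : σ.comp σ = AlgHom.id _ _ := by
    have hid : (-LinearMap.id : ZMod 3 →ₗ[ZMod 3] ZMod 3).comp (-LinearMap.id) = LinearMap.id := by
      ext; simp
    rw [hσ, ← TrivSqZeroExt.map_comp_map, hid, TrivSqZeroExt.map_id]
  obtain ⟨s, hs⟩ :
      ∃ s : TrivSqZeroExt (ZMod 3) (ZMod 3) ≃ₐ[ZMod 3] TrivSqZeroExt (ZMod 3) (ZMod 3),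
        ∀ x, s x = σ x :=
    ⟨AlgEquiv.ofAlgHom σ σ hσσ hσσ, fun _ => rfl⟩
  -- `s x - x = (-2 · snd x) ε` and `s ε ≠ ε`
  have hsx : ∀ x : TrivSqZeroExt (ZMod 3) (ZMod 3),
      s • x - x = TrivSqZeroExt.inl (-x.snd - x.snd) * TrivSqZeroExt.inr 1 := by
    intro x
    rw [AlgEquiv.smul_def, hs, hσ, TrivSqZeroExt.inl_mul_inr]
    refine TrivSqZeroExt.ext ?_ ?_ <;> simp
  have hsε : s • (TrivSqZeroExt.inr 1 : TrivSqZeroExt (ZMod 3) (ZMod 3)) ≠ TrivSqZeroExt.inr 1 := by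
    intro h1
    rw [AlgEquiv.smul_def, hs, hσ, TrivSqZeroExt.map_inr, LinearMap.neg_apply,
      LinearMap.id_apply] at h1
    have h2 := congrArg TrivSqZeroExt.snd h1
    rw [TrivSqZeroExt.snd_inr, TrivSqZeroExt.snd_inr] at h2
    exact absurd h2 (by decide)
  -- `𝔓 = (ε)`, `𝔓² = 0`
  obtain ⟨𝔓, h𝔓⟩ : ∃ 𝔓 : Ideal (TrivSqZeroExt (ZMod 3) (ZMod 3)),
      𝔓 = Ideal.span {TrivSqZeroExt.inr 1} := ⟨_, rfl⟩
  have h𝔓sq : 𝔓 ^ 2 = ⊥ := by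
    rw [h𝔓, Ideal.span_singleton_pow, Ideal.span_singleton_eq_bot, pow_two,
      TrivSqZeroExt.inr_mul_inr]
  -- `s ∈ G_0 ∖ G_1` for `𝔓`, so `i_G(s) < ∞`
  have hs0 : s ∈ 𝔓.ramificationSubgroup _ 0 := by
    rw [Ideal.ramificationSubgroup_zero, Ideal.inertia, AddSubgroup.mem_inertia]
    intro x
    change s • x - x ∈ 𝔓
    rw [hsx x, h𝔓]
    exact Ideal.mul_mem_left _ _ (Ideal.mem_span_singleton_self _)
  have hs1 : s ∉ 𝔓.ramificationSubgroup _ 1 := by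
    intro h1
    have h2 : s • (TrivSqZeroExt.inr 1 : TrivSqZeroExt (ZMod 3) (ZMod 3)) - TrivSqZeroExt.inr 1 ∈
        𝔓 ^ 2 :=
      (Ideal.mem_ramificationSubgroup_iff.mp h1).2 (TrivSqZeroExt.inr 1)
    rw [h𝔓sq, Ideal.mem_bot, sub_eq_zero] at h2
    exact hsε h2
  have hfin : lowerIndex 𝔓 _ s ≠ ⊤ := fun htop => hs1 ((lowerIndex_eq_top_iff 𝔓).mp htop 1)
  -- every `G_i` of the unit ideal is all of `G`, so `i_Q(s) = ∞` for `𝔮 = ⊤`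
  have htop : lowerIndex (⊤ : Ideal (TrivSqZeroExt (ZMod 3) (ZMod 3))) _ s = ⊤ := by
    have h1 : (⊤ : Ideal (TrivSqZeroExt (ZMod 3) (ZMod 3))) = 1 := Ideal.one_eq_top.symm
    refine (lowerIndex_eq_top_iff (⊤ : Ideal (TrivSqZeroExt (ZMod 3) (ZMod 3)))).mpr fun i =>
      Ideal.mem_ramificationSubgroup_iff.mpr ⟨?_, ?_⟩
    · rw [h1, smul_one]
    · intro x
      rw [Ideal.top_pow]
      exact Submodule.mem_top
  -- `π = id`, `H = ker π` is trivial: `#H_0 = 1` and the sum is the single term `i_G(s)`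
  obtain ⟨π, hπ⟩ : ∃ π : (TrivSqZeroExt (ZMod 3) (ZMod 3) ≃ₐ[ZMod 3] TrivSqZeroExt (ZMod 3) (ZMod 3)) →*
      (TrivSqZeroExt (ZMod 3) (ZMod 3) ≃ₐ[ZMod 3] TrivSqZeroExt (ZMod 3) (ZMod 3)),
        π = MonoidHom.id _ := ⟨_, rfl⟩
  have hπ' : ∀ g, π g = g := fun g => by rw [hπ, MonoidHom.id_apply]
  have hker1 : ∀ t : π.ker, t.1 = 1 := fun t => by
    rw [← hπ' t.1]
    exact t.2
  haveI : Subsingleton π.ker := ⟨fun a b => Subtype.ext (by rw [hker1 a, hker1 b])⟩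
  haveI : Unique π.ker := uniqueOfSubsingleton 1
  have hsker : s ∉ π.ker := fun hmem => by
    have h1 : π s = 1 := hmem
    rw [hπ'] at h1
    exact hsε (by rw [h1, one_smul])
  have key := h _ 𝔓 _ (TrivSqZeroExt (ZMod 3) (ZMod 3)) ⊤ _ π
  dsimp only [IndexFormula] at key
  have key' := key s hs0 hsker
  simp only [finsum_unique, hker1, mul_one, hπ', htop, Nat.card_unique, Nat.cast_one,
    one_mul] at key'
  exact hfin key'.symm

end Counterexample

end Literature.NumberTheory.GaloisRepresentations
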